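import Literature.MathematicalPhysics.QuantumFieldTheory.Balaban1983to89.T3MinimiserStabilityReduction
import Literature.MathematicalPhysics.QuantumFieldTheory.Balaban1983to89.T3PrintedRegularMinimiser
import Literature.MathematicalPhysics.QuantumFieldTheory.Balaban1983to89.T3OrbitAverage
import Literature.MathematicalPhysics.QuantumFieldTheory.Balaban1983to89.B12ContinuousTransportInvariance
import Literature.MathematicalPhysics.QuantumFieldTheory.Balaban1983to89.Node00.CanonicalTransportOfRecord
import Literature.MathematicalPhysics.QuantumFieldTheory.Balaban1983to89.T3InteriorExcision
import Summits.QuantumFields.YangMills.Theorems.FluctuationComparisonRegPrIntLSupTailReduction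
import Summits.QuantumFields.YangMills.Theorems.FluctuationComparisonRegPrIntLSupTailDepthInduction
import Summits.QuantumFields.YangMills.Theorems.FluctuationComparisonRegPrIntLWreg
import Summits.QuantumFields.YangMills.Theorems.FluctuationComparisonRegPrIntLSupTailFibreOdds
import Summits.QuantumFields.YangMills.Theorems.AlphaInputsT3ACMinimiserPinMeasurable
import HarnessLib

/-!
# LINE g22-6 «tube_harnack» — TUBE∘ CUT ALONG ITS OWN DOCSTRING: a K-UNIFORM FIBRE HARNACK CONSTANT for the level-(J+1) effective density (FH∘, the
# renormalisation content) × a K-FREE VOLUME FLOOR of link-tubes under the conditional HAAR law of the one-step fibre (FV∘, geometry); the junction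
# TUBE∘ ⟸ FH∘ + FV∘ is PROVED (disintegration of product Haar along the one-step averaging; here `Measurable σ` is USED)
# (crux `UnitScaleTilt.FluctuationComparisonRegPrIntL`, stmt-QuantumFields-20520; ideator `ym-r3-idea-1` g22, LENS «control»; organ-level line, NOT registered — RULING №36)

THE CONTROL QUESTION.  After tonight GEOM∘ ∕ KRN∘ ∕ GEOMfib∘ are theorems (LINE g22-5 v1.1 ✓`interiorSectionCan_holds`; LEAD w3-20520 g18's Theorems files) and
PERS₁∘ ⟸ TUBE∘ ALONE (✓`SectionLift.oneLevelPersistence_of_tube`).  TUBE∘ `SectionTubeMassIntCan` (row of LINE g22-4, text VERBATIM below) asks: for a measurable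
admissible section `σ` of the one-step averaging over the interior window and a radius `r > 0`, a floor `q > 0`, UNIFORM IN THE RUN `K ≥ J+1`, with
`q·Gibbs_K(D_{J,K}⁻¹B) ≤ Gibbs_K(D_{J,K}⁻¹B ∩ T_σ)` for every measurable interior `B`, `T_σ = {V | every bond of D_{J+1,K}V is r-close to σ(D_{J,K}V)}`.  Its own
docstring names three ingredients: (i) a LOWER bound of the level-(J+1) effective density on small fields, (iii) an UPPER bound of the fibre partition function (large
fields included) — both uniform in `K` — and (ii) the fibre GEOMETRY: the conditional volume of an `r`-tube portion bounded below uniformly in the datum.  WHICH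
QUANTITY IS CONTROLLED UNIFORMLY IN `K`?  Exactly one: the HARNACK RATIO of the canonical effective density `heightDensity F γ (J+1 ≤ K) univ` (lit ✓`T3TiltDescent.heightDensity`,
the density of `(D_{J+1,K})_* Gibbs_K` w.r.t. product Haar up to `Z_K⁻¹`, lit ✓`map_descendTo_restrict_eq_withDensity`) across ONE FIBRE of the one-step averaging:
«ess-sup over the fibre ≤ C_H⁻¹ · ess-inf over the r-tube ∩ small fields of the fibre», ess w.r.t. the CONDITIONAL HAAR LAW `λ_U = condLaw dU_{J+1} D_{J,J+1} U`
(lit ✓`T4AveragingDisintegration.condLaw`), `C_H` chosen BEFORE `K`.  Everything else is `K`-free.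

THE CUT (two new rows, §2; TUBE∘'s prefix VERBATIM up to the admissibility clause, so the junction aligns prefixes by `min ∕ max`):
* FH∘ `FibreHarnackCan` (NEW, the renormalisation content): `∃ C_H > 0, ∀ K ≥ J+1, for (dU_{J+1}.map D_{J,J+1})-a.e. interior U, for λ_U-a.e. W in
  tube_r(σU) ∩ {PlaqSmall 2θ_{J+1}(b₀)}:  C_H · ∫ heightDensity dλ_U ≤ heightDensity(W)` (in `ℝ≥0∞`) — on the small tube the effective density is at least a K-UNIFORM
  FRACTION OF ITS FIBRE AVERAGE.  Essential, version-free (`heightDensity` is the CANONICAL density; bounds `λ_U`-a.e. for a.e. `U`, i.e. `dU_{J+1}`-a.e.); the lower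
  bound only on SMALL fields of the tube (the enlarged class `2θ_{J+1}(b₀)` — any fixed enlargement of the admissibility class works; for `4r ≤ θ_{J+1}(b₀)` the whole
  tube is inside it by ✓`plaqSmall_of_linkClose`), the average over the WHOLE fibre (large fields: (iii), domination only — they sit inside an integral, never under
  a pointwise bound, so no version ∕ peak trap; [Balaban1985UV3] (7), (41)).  The fibre average carries `Z_K`, the fibre's minimal action, … — all of which cancel:
  only the RATIO `C_H` is asked uniformly.  This is (i)+(iii) of TUBE∘'s docstring in Harnack form.
* FV∘ `FibreTubeVolumeCan` (NEW, K-FREE geometry): `∃ v > 0, for (dU_{J+1}.map D_{J,J+1})-a.e. interior U:  v ≤ λ_U(tube_r(σU) ∩ {PlaqSmall 2θ_{J+1}(b₀)})` — the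
  conditional Haar law of the one-step fibre charges the small-field part of every `r`-link-tube around the section's point, uniformly in the datum.  No `K`, no
  Gibbs factor, no renormalisation: the regularity of Bałaban's averaging map on regular configurations ([Balaban1985Averaging] Prop. 1–2; the W7 local inverse
  `…MiddleBondRepair.exists_exact_repair` is the pointwise germ) read through the coarea ∕ disintegration formula.  (ii) of TUBE∘'s docstring, isolated.
THE JUNCTION (§4, PROVED, sorry-free): `sectionTubeMass_of_harnack_volume : FibreHarnackCan → FibreTubeVolumeCan → SectionTubeMassIntCan` with `q := C_H·v`:
tower identity lit ✓`descendTo_descendTo` (`D_{J,K} = D_{J,J+1} ∘ D_{J+1,K}`) turns `D_{J,K}⁻¹B ∩ T_σ` into `D_{J+1,K}⁻¹(D_{J,J+1}⁻¹B ∩ T′)`, `T′ = {W | W ∈ tube_r(σ(D_{J,J+1}W))}`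
— MEASURABLE because `σ` is (here TUBE∘'s token `Measurable σ` is load-bearing: `Measure.map_apply`); the image law is `dU_{J+1}.withDensity (Z_K⁻¹·heightDensity)`
(lit ✓`map_descendTo_restrict_eq_withDensity`); the fibrewise-to-setwise door (§3 ✓`mul_le_withDensity_preimage_inter_of_fibrewise`, the generic theorem of LEAD
w3-20520 g18's signature `…SectionTubeFibrewise` 66fb9b477aeb3a1d §1, reproduced VERBATIM with credit — not yet importable; built on tree ✓C
`…SupTailFibreOdds.withDensity_preimage_inter_eq_lintegral_condLaw` and lit ✓`condLaw_fibre_ae`) reduces TUBE∘ at `(J, K)` to the fibrewise inequality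
`ofReal(C_H v)·∫ w dλ_U ≤ ∫_{tube∩small} w dλ_U`, `w = ofReal(Z_K⁻¹·heightDensity)`, which is FH∘ × FV∘: `∫ w dλ_U = Z_K⁻¹·I` (`I` the fibre average) and
`∫_{tube∩small} w dλ_U ≥ Z_K⁻¹C_H I·λ_U(tube∩small) ≥ Z_K⁻¹ C_H I v` (✓`setLIntegral_mono_ae'`, `λ_U` a Markov kernel).

§4b (v1.1): ✓`haarTube_of_fibreTubeVolume` — FV∘'s fibre statement ⇒ the SETWISE one-step Haar tube charge ⟨HAAR-TUBE₁⟩ of LEAD w3-20520 g18's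
TUBE∘-SPLIT (bus 06:22:42Z; the door with `w ≡ 1`), so FV∘ docks into both cuts.

THE LINE.  TUBE∘ ⟸ (PROVED) FH∘ + FV∘.  STUBS (2, §5): FH∘ `stub_fibreHarnackCan`, FV∘ `stub_fibreTubeVolumeCan`.  Concluder: `sectionTubeMassIntCan_of_stubs :
SectionTubeMassIntCan` (TUBE∘ by name; PERS₁∘ then follows by LINE g22-5 v1.1 ✓`oneLevelPersistence_of_tube`, POS∘ by LINE g22-2's door).  `lean check`: rc 0, sorries =
the 2 stubs, 0 elsewhere.
v1.2 (06:57Z): lint-clean (deprecated `mul_le_mul_left'` → `mul_le_mul_right`; unused binder `_hσm` in §4b — FV∘ ⇒ ⟨HAAR-TUBE₁⟩ needs NO measurability of σ); row bodies TUBE∘ ∕ FH∘ ∕ FV∘ byte-identical to v1.1.  Critic #439 (PASS-WITH-PRICE, light): P1 = instrument letter FL-5a (FV∘ sizing) ∕ FL-5b ∕ FL-6 SENT 06:53Z; P2 = FH∘'s first target NAMED: the sub-row «FH∘|mode» — FH∘'s inequality asserted only at the fibre's conditional MODE∕minimiser W⋆(U) (K-uniform bound on log hd(W⋆(U)) − log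 ∫ hd dλ_U), instrument cell FL-5b (K-dependence of the fibre precision d_K, D_K; KILL: growth ≥ 1.25×∕level twice running); P3 = this lint pass.  FL-3 RESULT (06:50:40Z, Gaussian toy, GUIDANCE) read for this line: the conditional-mean section of an interior-½ datum sits at 0.62–0.66 of the FULL level-(J+1) window (n = 4; 0.45–0.49 at n = 2) ⇒ TUBE∘'s admissibility class θ_{J+1}(b₀) and the small class 2θ_{J+1}(b₀) are on the surviving side («interior ⇒ full window», margin ≈ 1.5), while same-fraction interior→interior persistence holds only with volume- and datum-small q (q after F: as typed).

WHY THIS IS THE «CONTROL» CUT AND NOT A SHRED.  FH∘ is strictly WEAKER than TUBE∘'s fibrewise form ⟨FIB-TUBE∘⟩ (LEAD w3 g18) in what it asks to be K-uniform — one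
scalar ratio per fibre, no tube volume, no measure of sets — and names the instrument letter: the two-sided oscillation of `log heightDensity` across one fibre's small
fields is `β_{J+1}·osc(A_eff) ≤ b₀²(1+log β_{J+1})^{2p₀}·Vol_{J+1}` (K-free by [Balaban1987RG1] §1's bounded analytic corrections) and the large-field domination is
[Balaban1985UV3] (41); FV∘ is decidable by a finite-dimensional computation at `L = 3` (fibre volumes of the exp-mean-log averaging — an FL letter for the instrument
seat) and provable in principle from the W7 local structure.  Neither stub restates TUBE∘: FH∘ has no tube-volume and no `q`, FV∘ has no `K` and no Gibbs factor
(BC2∕BC7 probes in the companion probe file).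

HONEST STATUS.  Nothing of Bałaban's is asserted: FH∘ and FV∘ are candidate rows (stubs), the junction is kernel-checked bookkeeping (disintegration + tower
identity); TUBE∘ ∕ FH∘ ∕ FV∘ ∕ PERS₁∘ ∕ POS∘ ∕ PLAQTAIL∘ ∕ LFR♯ᶜ∘ ∕ S2β ∕ 20520 are NOT proved; `YM3TorusSU2` is NOT proved; rung R3 — NOT d = 4, NOT infinite volume, NOT a
mass gap, NOT Clay; no summit is proved by a line.

References: [Balaban1985UV3] (2) p.256, (7) p.257, Thm 2 p.263, (38)–(41) p.266; [Balaban1987RG1] (0.11) p.253, (0.18)–(0.22) p.255, §1; [Balaban1985Averaging] (10)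
p.19, Prop. 1–2 pp.22–26; [Balaban1988Convergent] §2; Federer, Geometric Measure Theory 3.2.12 (coarea).
-/

open MeasureTheory Filter Topology Set
open scoped ENNReal NNReal BigOperators
open Literature.MathematicalPhysics.QuantumFieldTheory.Balaban1983to89
open Literature.MathematicalPhysics.QuantumFieldTheory.Balaban1983to89.T3ContinuumYM3Torus
open Literature.MathematicalPhysics.QuantumFieldTheory.Balaban1983to89.T3NestedUnitLaws
open Literature.MathematicalPhysics.QuantumFieldTheory.Balaban1983to89.T3UnitLawDensityEML
open Literature.MathematicalPhysics.QuantumFieldTheory.Balaban1983to89.T3UnitScaleTilt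
open Literature.MathematicalPhysics.QuantumFieldTheory.Balaban1983to89.T3TiltDescent
open Literature.MathematicalPhysics.QuantumFieldTheory.Balaban1983to89.T3PrintedRegularMinimiser
open Literature.MathematicalPhysics.QuantumFieldTheory.Balaban1983to89.T3ConstrainedMinimiser (fibre)
open Literature.MathematicalPhysics.QuantumFieldTheory.Balaban1983to89.T3LevelShift
open Literature.MathematicalPhysics.QuantumFieldTheory.Balaban1983to89.Missing
open Literature.MathematicalPhysics.QuantumFieldTheory.Balaban1983to89.T4Continuum
open Literature.MathematicalPhysics.QuantumFieldTheory.Balaban1983to89.T3DescentFibreTower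
open scoped Literature.MathematicalPhysics.QuantumFieldTheory.Balaban1983to89.T3OrbitAverage
open Literature.MathematicalPhysics.QuantumFieldTheory.Balaban1983to89.T3InteriorExcision (θBal_mul θBal_mul_le)
open Literature.MathematicalPhysics.QuantumFieldTheory.Balaban1983to89.T4AveragingDisintegration (condLaw condLaw_fibre_ae)
open Literature.MathematicalPhysics.QuantumFieldTheory.Balaban1983to89.B12ContinuousTransportInvarianceOn (continuous_dist1_SU)

noncomputable section

set_option autoImplicit false

namespace Summit.QuantumFields.YangMills.Cruxes.FluctuationComparisonRegPrIntL.RunPairOrgan.TubeHarnack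

/-! ## §1 THE ROW CONCLUDED: TUBE∘ (LINE g22-4 `persistence_geometry.lean` ll.137–158, text VERBATIM — bridge `Iff.rfl` in any file seeing both) -/

section Rows

/-- **TUBE∘ · THE CONDITIONAL LAW OF THE NEXT LEVEL CHARGES EVERY SMALL-FIELD TUBE AROUND THE FIBRE, UNIFORMLY IN THE RUN** (`SectionTubeMassIntCan`, NEW,
MEASURE): in the shared shape, for every window level `J`, every radius `r > 0` and every MEASURABLE section `σ` of the one-step averaging over the interior window
with SMALL-FIELD values (`σ U ∈ W_{J+1}(b₀)` for `U ∈ W_J(c·b₀)`) there is `q > 0` (chosen after `F, γ, J, r, σ`: positivity, no rate) such that for every run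
`K ≥ J + 1` and every measurable `B ⊆ W_J(c·b₀)`: `q·Gibbs_K(D_{J,K}⁻¹B) ≤ Gibbs_K(D_{J,K}⁻¹B ∩ {V : |σ(D_{J,K}V)(b)⁻¹·(D_{J+1,K}V)(b) − 1| < r ∀ bonds b})` — the
`r`-link-tube around the section's point ON THE FIBRE of the datum carries conditional mass `≥ q`, UNIFORMLY IN `K`.  Content: after `K − J − 1` renormalization
steps the effective density of level `J+1` is bounded BELOW on small fields (`exp(−β_{J+1}·Wilson − E·Vol)`, the small-field effective action's bounded analytic
corrections) and the fibre partition function ABOVE (`exp(+E·Vol)`, ultraviolet stability) — both uniformly in `K`, constants extensive and `β_{J+1}`-dependent (all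
fixed after `F, γ, J`).  No window geometry, no rate: pure positivity of Bałaban's conditional small-field law at fixed height as the cutoff is removed.  WHY IT MIGHT
FAIL: (i) the LOWER density bound needs the complete small-field analysis at height `K − J − 1` (analyticity domains, [Balaban1987RG1]) — print gives it, size XL;
(ii) the fibre geometry (fibre volume of an `r`-tube portion) must be bounded below uniformly in `U` up to the closed window edge — regularity of the averaging map
on regular configurations ([Balaban1985Averaging] Prop. 1); (iii) large-field contributions enter only the partition function's UPPER bound ((7) covers them).
[cite: Balaban1985UV3, (7) p.257 and (38)-(40) p.266; Balaban1987RG1, (0.18)-(0.22) p.255; Balaban1985Averaging, Prop. 1 p.22] -/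
def SectionTubeMassIntCan : Prop :=
  ∀ (L : ℕ), ∃ c₀ : ℝ, 0 < c₀ ∧ c₀ ≤ 1 ∧ ∀ (c : ℝ), 0 < c → c ≤ c₀ → ∃ pS : ℝ, ∀ (b₀ p₀ : ℝ), 0 < b₀ → pS ≤ p₀ → 0 < p₀ →
    ∃ γ₁ : ℝ, 0 < γ₁ ∧ ∀ (F : T3Family) (γ : ℝ), F.L = L → 0 < γ → γ ≤ γ₁ →
      ∀ (J : ℕ) (r : ℝ), 0 < r →
        ∀ σ : GaugeField (F.P J) 0 (Matrix.specialUnitaryGroup (Fin 2) ℂ) → GaugeField (F.P (J + 1)) 0 (Matrix.specialUnitaryGroup (Fin 2) ℂ), Measurable σ →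
          (∀ U : GaugeField (F.P J) 0 (Matrix.specialUnitaryGroup (Fin 2) ℂ), PlaqSmall (θBal F.L γ (c * b₀) p₀ J) U →
            descendTo F ℰp J (J + 1) (Nat.le_succ J) (σ U) = U ∧ PlaqSmall (θBal F.L γ b₀ p₀ (J + 1)) (σ U)) →
          ∃ q : ℝ, 0 < q ∧ ∀ (K : ℕ) (hJK : J + 1 ≤ K)
            (B : Set (GaugeField (F.P J) 0 (Matrix.specialUnitaryGroup (Fin 2) ℂ))), MeasurableSet B →
              B ⊆ {U | PlaqSmall (θBal F.L γ (c * b₀) p₀ J) U} →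
              ENNReal.ofReal q * gibbsK F ℰp γ K (descendTo F ℰp J K ((Nat.le_succ J).trans hJK) ⁻¹' B) ≤
                gibbsK F ℰp γ K (descendTo F ℰp J K ((Nat.le_succ J).trans hJK) ⁻¹' B ∩
                  {V | ∀ b : PBond (F.P (J + 1)) 0,
                    dist1 ((σ (descendTo F ℰp J K ((Nat.le_succ J).trans hJK) V) b)⁻¹ *
                      descendTo F ℰp (J + 1) K hJK V b) < r})

/-! ## §2 THE CUT: FH∘ (fibre Harnack constant, K-uniform — renormalisation content) and FV∘ (fibre tube volume floor, K-free — geometry) -/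

/-- **FH∘ · K-UNIFORM FIBRE HARNACK CONSTANT FOR THE CANONICAL EFFECTIVE DENSITY** (`FibreHarnackCan`, NEW, MEASURE∕RENORMALISATION): in TUBE∘'s prefix (verbatim up
to the admissibility clause), for every measurable admissible section `σ` and radius `r > 0` there is `C_H > 0`, chosen BEFORE the run length, such that for every run
`K ≥ J+1` and `(dU_{J+1}.map D_{J,J+1})`-almost every INTERIOR datum `U`: for `λ_U`-almost every field `W` of the `r`-link-tube around `σ U` with plaquettes below
`2θ_{J+1}(b₀)` (small fields only), the canonical effective density `heightDensity F γ (J+1 ≤ K) univ` (lit ✓`T3TiltDescent.heightDensity`: `Z_K ×` the density of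
`(D_{J+1,K})_* Gibbs_K` w.r.t. product Haar, lit ✓`map_descendTo_restrict_eq_withDensity`) at `W` is at least the fraction `C_H` of its FIBRE AVERAGE
`∫ heightDensity dλ_U` (`λ_U = condLaw dU_{J+1} D_{J,J+1} U`, the conditional HAAR law of the one-step fibre — a probability; the average runs over the WHOLE fibre,
large fields included: they enter only this partition-function side, domination not pointwise control).  One scalar per fibre, stated in `ℝ≥0∞` (no `toReal` junk; the
fibre average is finite for a.e. `U` by integrability of `heightDensity`, lit ✓`heightDensity_props`).  Content = (i)+(iii) of TUBE∘'s docstring in Harnack form: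
`log heightDensity = −β_{J+1}A_eff + O(1)` on small fields with `β_{J+1}·osc_{fibre∩small}(A_eff) ≤ b₀²(1+log β_{J+1})^{2p₀}·Vol_{J+1}` (K-free: bounded analytic corrections
of the small-field effective action, [Balaban1987RG1] §1) and the fibre partition function dominated by its small-field part ([Balaban1985UV3] (7), (41)).  WHY IT
MIGHT FAIL: the K-uniform lower bound near an ARBITRARY admissible small point (not the conditional minimiser) needs the full small-field analysis at height `K−J−1`
plus the connectedness of the fibre's small-field region modulo the residual gauge (Poincaré-type lemma on blocks, [Balaban1985Averaging] Prop. 1); size XL.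
[cite: Balaban1985UV3, (2) p.256 and (7) p.257 and Thm 2 p.263 and (41) p.266; Balaban1987RG1, (0.18)-(0.22) p.255; Balaban1988Convergent, §2] -/
def FibreHarnackCan : Prop :=
  ∀ (L : ℕ), ∃ c₀ : ℝ, 0 < c₀ ∧ c₀ ≤ 1 ∧ ∀ (c : ℝ), 0 < c → c ≤ c₀ → ∃ pS : ℝ, ∀ (b₀ p₀ : ℝ), 0 < b₀ → pS ≤ p₀ → 0 < p₀ →
    ∃ γ₁ : ℝ, 0 < γ₁ ∧ ∀ (F : T3Family) (γ : ℝ), F.L = L → 0 < γ → γ ≤ γ₁ →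
      ∀ (J : ℕ) (r : ℝ), 0 < r →
        ∀ σ : GaugeField (F.P J) 0 (Matrix.specialUnitaryGroup (Fin 2) ℂ) → GaugeField (F.P (J + 1)) 0 (Matrix.specialUnitaryGroup (Fin 2) ℂ), Measurable σ →
          (∀ U : GaugeField (F.P J) 0 (Matrix.specialUnitaryGroup (Fin 2) ℂ), PlaqSmall (θBal F.L γ (c * b₀) p₀ J) U →
            descendTo F ℰp J (J + 1) (Nat.le_succ J) (σ U) = U ∧ PlaqSmall (θBal F.L γ b₀ p₀ (J + 1)) (σ U)) →
          ∃ C : ℝ, 0 < C ∧ ∀ (K : ℕ) (hJK : J + 1 ≤ K),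
            ∀ᵐ U ∂((fieldMeasure (F.P (J + 1)) 0 (Matrix.specialUnitaryGroup (Fin 2) ℂ)).map (descendTo F ℰp J (J + 1) (Nat.le_succ J))),
              PlaqSmall (θBal F.L γ (c * b₀) p₀ J) U →
                ∀ᵐ W ∂(condLaw (fieldMeasure (F.P (J + 1)) 0 (Matrix.specialUnitaryGroup (Fin 2) ℂ)) (descendTo F ℰp J (J + 1) (Nat.le_succ J)) U),
                  (∀ b : PBond (F.P (J + 1)) 0, dist1 ((σ U b)⁻¹ * W b) < r) → PlaqSmall (2 * θBal F.L γ b₀ p₀ (J + 1)) W →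
                    ENNReal.ofReal C *
                        ∫⁻ W', ENNReal.ofReal (heightDensity F γ hJK Set.univ W')
                          ∂(condLaw (fieldMeasure (F.P (J + 1)) 0 (Matrix.specialUnitaryGroup (Fin 2) ℂ)) (descendTo F ℰp J (J + 1) (Nat.le_succ J)) U) ≤
                      ENNReal.ofReal (heightDensity F γ hJK Set.univ W)

/-- **FV∘ · K-FREE VOLUME FLOOR OF SMALL-FIELD LINK-TUBES UNDER THE CONDITIONAL HAAR LAW OF THE ONE-STEP FIBRE** (`FibreTubeVolumeCan`, NEW, GEOMETRY): in TUBE∘'s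
prefix, for every measurable admissible section `σ` and radius `r > 0` there is `v > 0` with: for `(dU_{J+1}.map D_{J,J+1})`-almost every INTERIOR datum `U` the
conditional Haar law `λ_U = condLaw dU_{J+1} D_{J,J+1} U` (lit ✓`T4AveragingDisintegration.condLaw`: product Haar of level `J+1` disintegrated along the one-step
averaging) gives mass `≥ v` to `tube_r(σ U) ∩ {PlaqSmall 2θ_{J+1}(b₀)}`.  NO run length `K`, no Gibbs factor, no renormalisation: (ii) of TUBE∘'s docstring isolated —
the regularity of Bałaban's averaging map on regular configurations (submersion with uniformly non-degenerate differential on small fields; the W7 per-bond local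
inverse `…MiddleBondRepair.exists_exact_repair` is its pointwise germ) read through the coarea∕disintegration formula: `λ_U` is Jacobian-weighted volume on the fibre
manifold, of full support, and an `r`-ball (for `4r ≤ θ_{J+1}(b₀)` the whole tube is in the enlarged small class, ✓`PersistenceGeometry.plaqSmall_of_linkClose`) has
volume bounded below by compactness.  Decidable in principle by a finite-dimensional computation at `L = 3`.  WHY IT MIGHT FAIL: uniformity in the datum `U` up to the
window's edge and in the admissible point `σ U` is a compactness claim over a merely MEASURABLE family — it needs the non-degeneracy of the averaging's differential on
the CLOSED small class, and Lean has no coarea formula (size M–L as mathematics, L as formalisation). [cite: Balaban1985Averaging, (10) p.19 and Prop. 1 p.22;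
Balaban1987RG1, (0.11) p.253] -/
def FibreTubeVolumeCan : Prop :=
  ∀ (L : ℕ), ∃ c₀ : ℝ, 0 < c₀ ∧ c₀ ≤ 1 ∧ ∀ (c : ℝ), 0 < c → c ≤ c₀ → ∃ pS : ℝ, ∀ (b₀ p₀ : ℝ), 0 < b₀ → pS ≤ p₀ → 0 < p₀ →
    ∃ γ₁ : ℝ, 0 < γ₁ ∧ ∀ (F : T3Family) (γ : ℝ), F.L = L → 0 < γ → γ ≤ γ₁ →
      ∀ (J : ℕ) (r : ℝ), 0 < r →
        ∀ σ : GaugeField (F.P J) 0 (Matrix.specialUnitaryGroup (Fin 2) ℂ) → GaugeField (F.P (J + 1)) 0 (Matrix.specialUnitaryGroup (Fin 2) ℂ), Measurable σ →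
          (∀ U : GaugeField (F.P J) 0 (Matrix.specialUnitaryGroup (Fin 2) ℂ), PlaqSmall (θBal F.L γ (c * b₀) p₀ J) U →
            descendTo F ℰp J (J + 1) (Nat.le_succ J) (σ U) = U ∧ PlaqSmall (θBal F.L γ b₀ p₀ (J + 1)) (σ U)) →
          ∃ v : ℝ, 0 < v ∧
            ∀ᵐ U ∂((fieldMeasure (F.P (J + 1)) 0 (Matrix.specialUnitaryGroup (Fin 2) ℂ)).map (descendTo F ℰp J (J + 1) (Nat.le_succ J))),
              PlaqSmall (θBal F.L γ (c * b₀) p₀ J) U →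
                ENNReal.ofReal v ≤
                  (condLaw (fieldMeasure (F.P (J + 1)) 0 (Matrix.specialUnitaryGroup (Fin 2) ℂ)) (descendTo F ℰp J (J + 1) (Nat.le_succ J)) U)
                    {W | (∀ b : PBond (F.P (J + 1)) 0, dist1 ((σ U b)⁻¹ * W b) < r) ∧ PlaqSmall (2 * θBal F.L γ b₀ p₀ (J + 1)) W}

end Rows

/-! ## §3 THE DOOR: a fibrewise lower fraction is a setwise one (generic; LEAD w3-20520 g18's `…SectionTubeFibrewise` 66fb9b477aeb3a1d §1, reproduced VERBATIM
with credit — that file is a SIGNATURE tonight, not yet importable; it rests on tree ✓C `…SupTailFibreOdds.withDensity_preimage_inter_eq_lintegral_condLaw` and lit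
✓`condLaw_fibre_ae`) -/

section Door

open ProbabilityTheory
open Literature.MathematicalPhysics.QuantumFieldTheory.Balaban1983to89.T4AveragingDisintegration
open Summit.QuantumFields.YangMills.Theorems.FluctuationComparisonRegPrIntLSupTailFibreOdds (withDensity_preimage_inter_eq_lintegral_condLaw)

variable {α β : Type*} [MeasurableSpace α] [MeasurableSpace β] [StandardBorelSpace β] [Nonempty β] [MeasurableEq α]

/-- ★ **FIBREWISE CHARGE ⇒ SETWISE CHARGE OF AN ARBITRARY TARGET** (LEAD w3-20520 g18, `…SectionTubeFibrewise` §1, verbatim): `ν` finite on a standard Borel fine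
space, `D` measurable, `w` a measurable weight, `E U` ANY family of fine events and `T` ANY fine set with `E U ∩ D⁻¹{U} ⊆ T` for `U` in the window `W`.  If for
`(ν.map D)`-a.e. `U ∈ W` the `w`-weighted conditional law `κ_U = condLaw ν D U` gives `q·∫⁻ w dκ_U ≤ ∫⁻_{E U} w dκ_U`, then `q·(ν.withDensity w)(D⁻¹B) ≤
(ν.withDensity w)(D⁻¹B ∩ T)` for every measurable `B ⊆ W`. [cite: Balaban1985Averaging, (10) p.19] -/
theorem mul_le_withDensity_preimage_inter_of_fibrewise (ν : Measure β) [IsFiniteMeasure ν] {D : β → α} (hD : Measurable D)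
    {w : β → ℝ≥0∞} (hw : Measurable w) {W : Set α} (E : α → Set β) {T : Set β}
    (hET : ∀ U ∈ W, ∀ V, D V = U → V ∈ E U → V ∈ T) {q : ℝ≥0∞}
    (hfib : ∀ᵐ U ∂(ν.map D), U ∈ W → q * ∫⁻ V, w V ∂(condLaw ν D U) ≤ ∫⁻ V in E U, w V ∂(condLaw ν D U)) :
    ∀ B : Set α, MeasurableSet B → B ⊆ W → q * (ν.withDensity w) (D ⁻¹' B) ≤ (ν.withDensity w) (D ⁻¹' B ∩ T) := by
  intro B hB hBW
  have hSm : MeasurableSet (toMeasurable (ν.withDensity w) (D ⁻¹' B ∩ T)) := measurableSet_toMeasurable _ _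
  have hAS : D ⁻¹' B ∩ T ⊆ toMeasurable (ν.withDensity w) (D ⁻¹' B ∩ T) := subset_toMeasurable _ _
  rw [← measure_toMeasurable (D ⁻¹' B ∩ T)]
  refine le_trans ?_ (measure_mono (Set.inter_subset_right : D ⁻¹' B ∩ toMeasurable (ν.withDensity w) (D ⁻¹' B ∩ T) ⊆ _))
  rw [withDensity_preimage_inter_eq_lintegral_condLaw ν hD hw hB hSm]
  have huniv : (ν.withDensity w) (D ⁻¹' B) = ∫⁻ U in B, (∫⁻ V, w V ∂(condLaw ν D U)) ∂(ν.map D) := by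
    rw [← Set.inter_univ (D ⁻¹' B), withDensity_preimage_inter_eq_lintegral_condLaw ν hD hw hB MeasurableSet.univ]
    simp only [Measure.restrict_univ]
  rw [huniv, ← lintegral_const_mul q hw.lintegral_kernel]
  refine setLIntegral_mono_ae' hB ?_
  filter_upwards [hfib, condLaw_fibre_ae ν hD] with U hU hfibre hUB
  refine (hU (hBW hUB)).trans ?_
  have hF : {V : β | D V = U} =ᵐ[condLaw ν D U] (Set.univ : Set β) := by
    rw [ae_eq_univ]
    exact (prob_compl_eq_zero_iff (measurableSet_eq_fun hD measurable_const)).mpr hfibre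
  calc ∫⁻ V in E U, w V ∂(condLaw ν D U) = ∫⁻ V in E U ∩ {V : β | D V = U}, w V ∂(condLaw ν D U) :=
        (setLIntegral_congr (MeasureTheory.inter_ae_eq_left_of_ae_eq_univ hF)).symm
    _ ≤ ∫⁻ V in toMeasurable (ν.withDensity w) (D ⁻¹' B ∩ T), w V ∂(condLaw ν D U) :=
        lintegral_mono_set fun V hV => hAS ⟨show D V ∈ B by rw [hV.2]; exact hUB, hET U (hBW hUB) V hV.2 hV.1⟩

end Door

/-! ## §4 THE JUNCTION (PROVED): TUBE∘ ⟸ FH∘ + FV∘ -/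

section Junction

open ProbabilityTheory
open Literature.MathematicalPhysics.QuantumFieldTheory.Balaban1983to89.T4AveragingDisintegration
open Summit.QuantumFields.YangMills.Theorems.MinimiserPin (secondCountableTopology_su2)

/-- Measurability of the moving tube `T′ = {W | every bond of W is r-close to σ(D W)}` for a MEASURABLE centre map `σ ∘ D` (TUBE∘'s token `Measurable σ` is used
here and only here). [folklore] -/
theorem measurableSet_movingTube {P : Params} {j : ℕ} {X : Type*} [MeasurableSpace X]
    (τ : GaugeField P j (Matrix.specialUnitaryGroup (Fin 2) ℂ) → X) (c : X → GaugeField P j (Matrix.specialUnitaryGroup (Fin 2) ℂ)) (hτ : Measurable τ) (hc : Measurable c) (r : ℝ) :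
    MeasurableSet {W : GaugeField P j (Matrix.specialUnitaryGroup (Fin 2) ℂ) | ∀ b : PBond P j, dist1 ((c (τ W) b)⁻¹ * W b) < r} := by
  haveI := secondCountableTopology_su2
  have hf : ∀ b : PBond P j, Measurable fun W : GaugeField P j (Matrix.specialUnitaryGroup (Fin 2) ℂ) => dist1 ((c (τ W) b)⁻¹ * W b) := by
    intro b
    have h1 : Measurable fun W : GaugeField P j (Matrix.specialUnitaryGroup (Fin 2) ℂ) => c (τ W) b := (measurable_pi_apply b).comp (hc.comp hτ)
    have h2 : Measurable fun W : GaugeField P j (Matrix.specialUnitaryGroup (Fin 2) ℂ) => W b := measurable_pi_apply b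
    exact (continuous_dist1_SU (N := 2)).measurable.comp (h1.inv.mul h2)
  rw [Set.setOf_forall]
  exact MeasurableSet.iInter fun b => measurableSet_lt (hf b) measurable_const

/-- The static tube `tube_r(W₀) ∩ {PlaqSmall θ}` is open, hence measurable. [folklore] -/
theorem measurableSet_tube_inter_plaqSmall {P : Params} {j : ℕ} (W₀ : GaugeField P j (Matrix.specialUnitaryGroup (Fin 2) ℂ)) (r θ : ℝ) :
    MeasurableSet {W : GaugeField P j (Matrix.specialUnitaryGroup (Fin 2) ℂ) | (∀ b : PBond P j, dist1 ((W₀ b)⁻¹ * W b) < r) ∧ PlaqSmall θ W} := by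
  rw [Set.setOf_and]
  refine (IsOpen.inter ?_ ?_).measurableSet
  · rw [Set.setOf_forall]
    exact isOpen_iInter_of_finite fun b => isOpen_lt
      ((continuous_dist1_SU (N := 2)).comp ((continuous_const.inv).mul (continuous_apply b))) continuous_const
  · exact Summit.QuantumFields.YangMills.Theorems.FluctuationComparisonRegPrIntLWregAssembly.isOpen_setOf_plaqSmall₂ P j θ

/-- ★★ **THE JUNCTION — TUBE∘ ⟸ FH∘ + FV∘** (PROVED, sorry-free; `q := C_H·v`): tower identity lit ✓`descendTo_descendTo`, image law lit
✓`map_descendTo_restrict_eq_withDensity` (`(D_{J+1,K})_* Gibbs_K = dU_{J+1}.withDensity (Z_K⁻¹·heightDensity)`), the door ✓`mul_le_withDensity_preimage_inter_of_fibrewise`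
with `E U := tube_r(σU) ∩ small`, `T := T′` (measurable by `Measurable σ`), and the fibrewise inequality FH∘ × FV∘ (`λ_U` is a probability).
[cite: Balaban1985UV3, (2) p.256 and (7) p.257 and (38)-(41) p.266; Balaban1987RG1, (0.11) p.253; Balaban1985Averaging, (10) p.19] -/
theorem sectionTubeMass_of_harnack_volume (hH : FibreHarnackCan) (hV : FibreTubeVolumeCan) : SectionTubeMassIntCan := by
  intro L
  obtain ⟨c₁, hc₁, hc₁1, H1⟩ := hH L
  obtain ⟨c₂, hc₂, -, H2⟩ := hV L
  refine ⟨min c₁ c₂, lt_min hc₁ hc₂, (min_le_left _ _).trans hc₁1, fun c hc hcle => ?_⟩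
  obtain ⟨pS₁, hp₁⟩ := H1 c hc (hcle.trans (min_le_left _ _))
  obtain ⟨pS₂, hp₂⟩ := H2 c hc (hcle.trans (min_le_right _ _))
  refine ⟨max pS₁ pS₂, fun b₀ p₀ hb₀ hpS hp₀ => ?_⟩
  obtain ⟨γa, hγa, Ha⟩ := hp₁ b₀ p₀ hb₀ ((le_max_left _ _).trans hpS) hp₀
  obtain ⟨γb, hγb, Hb⟩ := hp₂ b₀ p₀ hb₀ ((le_max_right _ _).trans hpS) hp₀
  refine ⟨min γa γb, lt_min hγa hγb, fun F γ hFL hγ hγle J r hr σ hσm hadm => ?_⟩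
  obtain ⟨C, hC, HC⟩ := Ha F γ hFL hγ (hγle.trans (min_le_left _ _)) J r hr σ hσm hadm
  obtain ⟨v, hv, HV⟩ := Hb F γ hFL hγ (hγle.trans (min_le_right _ _)) J r hr σ hσm hadm
  refine ⟨C * v, mul_pos hC hv, fun K hJK B hB hBW => ?_⟩
  -- notation
  set μ : Measure (GaugeField (F.P (J + 1)) 0 (Matrix.specialUnitaryGroup (Fin 2) ℂ)) := fieldMeasure (F.P (J + 1)) 0 (Matrix.specialUnitaryGroup (Fin 2) ℂ) with hμ
  set D₁ : GaugeField (F.P (J + 1)) 0 (Matrix.specialUnitaryGroup (Fin 2) ℂ) → GaugeField (F.P J) 0 (Matrix.specialUnitaryGroup (Fin 2) ℂ) := descendTo F ℰp J (J + 1) (Nat.le_succ J) with hD₁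
  set DK : GaugeField (F.P K) 0 (Matrix.specialUnitaryGroup (Fin 2) ℂ) → GaugeField (F.P (J + 1)) 0 (Matrix.specialUnitaryGroup (Fin 2) ℂ) := descendTo F ℰp (J + 1) K hJK with hDK_def
  set Z : ℝ := partitionFn (G := (Matrix.specialUnitaryGroup (Fin 2) ℂ)) (F.P K) ((F.scheme ℰp γ).β K) with hZ
  set hd : GaugeField (F.P (J + 1)) 0 (Matrix.specialUnitaryGroup (Fin 2) ℂ) → ℝ := heightDensity F γ hJK Set.univ with hhd
  set w : GaugeField (F.P (J + 1)) 0 (Matrix.specialUnitaryGroup (Fin 2) ℂ) → ℝ≥0∞ := fun W => ENNReal.ofReal (Z⁻¹ * hd W) with hw_def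
  have hD₁ : Measurable D₁ := measurable_descendTo F ℰp measurableE_ℰp _
  have hDK : Measurable DK := measurable_descendTo F ℰp measurableE_ℰp _
  have hZpos : 0 < Z := partitionFn_pos' _ (F.scheme_β_nonneg ℰp hγ.le K)
  obtain ⟨hdm, -⟩ := heightDensity_props F hJK (S := (Set.univ : Set (GaugeField (F.P K) 0 (Matrix.specialUnitaryGroup (Fin 2) ℂ)))) MeasurableSet.univ hγ.le
  have hw : Measurable w := (measurable_const.mul hdm).ennreal_ofReal
  -- the image law of the run at level J+1
  have hlaw : (gibbsK F ℰp γ K).map DK = μ.withDensity w := by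
    rw [← Measure.restrict_univ (μ := gibbsK F ℰp γ K)]
    exact map_descendTo_restrict_eq_withDensity F hJK MeasurableSet.univ hγ.le
  -- the moving tube and the tower identity
  set T' : Set (GaugeField (F.P (J + 1)) 0 (Matrix.specialUnitaryGroup (Fin 2) ℂ)) := {W | ∀ b : PBond (F.P (J + 1)) 0, dist1 ((σ (D₁ W) b)⁻¹ * W b) < r} with hT'
  have hT'm : MeasurableSet T' := measurableSet_movingTube D₁ σ hD₁ hσm r
  have htower : ∀ V : GaugeField (F.P K) 0 (Matrix.specialUnitaryGroup (Fin 2) ℂ), D₁ (DK V) = descendTo F ℰp J K ((Nat.le_succ J).trans hJK) V :=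
    fun V => descendTo_descendTo F ℰp (Nat.le_succ J) hJK V
  have hset : descendTo F ℰp J K ((Nat.le_succ J).trans hJK) ⁻¹' B ∩
      {V | ∀ b : PBond (F.P (J + 1)) 0,
        dist1 ((σ (descendTo F ℰp J K ((Nat.le_succ J).trans hJK) V) b)⁻¹ * descendTo F ℰp (J + 1) K hJK V b) < r} =
      DK ⁻¹' (D₁ ⁻¹' B ∩ T') := by
    ext V
    simp only [Set.mem_inter_iff, Set.mem_preimage, Set.mem_setOf_eq, hT', ← htower, ← hDK_def]
  have hpre : descendTo F ℰp J K ((Nat.le_succ J).trans hJK) ⁻¹' B = DK ⁻¹' (D₁ ⁻¹' B) := by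
    ext V
    simp only [Set.mem_preimage, ← htower]
  rw [hset, hpre, ← Measure.map_apply hDK (hD₁ hB), ← Measure.map_apply hDK ((hD₁ hB).inter hT'm), hlaw]
  -- the door, with E U := tube_r(σ U) ∩ small
  refine mul_le_withDensity_preimage_inter_of_fibrewise μ hD₁ hw
    (W := {U | PlaqSmall (θBal F.L γ (c * b₀) p₀ J) U})
    (fun U => {W | (∀ b : PBond (F.P (J + 1)) 0, dist1 ((σ U b)⁻¹ * W b) < r) ∧ PlaqSmall (2 * θBal F.L γ b₀ p₀ (J + 1)) W})
    (T := T') (fun U _ V hVU hVE => ?_) ?_ B hB hBW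
  · show ∀ b : PBond (F.P (J + 1)) 0, dist1 ((σ (D₁ V) b)⁻¹ * V b) < r
    rw [hVU]
    exact hVE.1
  -- the fibrewise inequality: FH∘ × FV∘
  filter_upwards [HC K hJK, HV] with U hHU hVU
  intro hUW
  have hlow := hHU hUW
  have hvU := hVU hUW
  haveI : IsMarkovKernel (condLaw μ D₁) := by unfold condLaw; infer_instance
  set κ := condLaw μ D₁ U with hκ
  set E : Set (GaugeField (F.P (J + 1)) 0 (Matrix.specialUnitaryGroup (Fin 2) ℂ)) :=
    {W | (∀ b : PBond (F.P (J + 1)) 0, dist1 ((σ U b)⁻¹ * W b) < r) ∧ PlaqSmall (2 * θBal F.L γ b₀ p₀ (J + 1)) W} with hE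
  have hEm : MeasurableSet E := measurableSet_tube_inter_plaqSmall (σ U) r _
  set I : ℝ≥0∞ := ∫⁻ W', ENNReal.ofReal (hd W') ∂κ with hI
  have hw_eq : ∀ W, w W = ENNReal.ofReal Z⁻¹ * ENNReal.ofReal (hd W) := fun W =>
    ENNReal.ofReal_mul (inv_nonneg.mpr hZpos.le)
  -- total: ∫ w dκ = Z⁻¹ · I
  have htot : ∫⁻ W, w W ∂κ = ENNReal.ofReal Z⁻¹ * I := by
    rw [hI, ← lintegral_const_mul (ENNReal.ofReal Z⁻¹) hdm.ennreal_ofReal]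
    exact lintegral_congr fun W => hw_eq W
  -- on the small tube: w ≥ Z⁻¹ · C · I  (κ-a.e.), and κ(E) ≥ v
  have hlow' : ENNReal.ofReal Z⁻¹ * (ENNReal.ofReal C * I) * ENNReal.ofReal v ≤ ∫⁻ W in E, w W ∂κ := by
    calc ENNReal.ofReal Z⁻¹ * (ENNReal.ofReal C * I) * ENNReal.ofReal v
        ≤ ENNReal.ofReal Z⁻¹ * (ENNReal.ofReal C * I) * κ E := by gcongr
      _ = ∫⁻ W in E, ENNReal.ofReal Z⁻¹ * (ENNReal.ofReal C * I) ∂κ := by rw [setLIntegral_const]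
      _ ≤ ∫⁻ W in E, w W ∂κ := by
          refine setLIntegral_mono_ae' hEm ?_
          filter_upwards [hlow] with W hW hWE
          rw [hw_eq W]
          exact mul_le_mul_right (hW hWE.1 hWE.2) _
  -- combine
  calc ENNReal.ofReal (C * v) * ∫⁻ W, w W ∂κ
      = ENNReal.ofReal Z⁻¹ * (ENNReal.ofReal C * I) * ENNReal.ofReal v := by
        rw [htot, ENNReal.ofReal_mul hC.le]
        ring
    _ ≤ ∫⁻ W in E, w W ∂κ := hlow'

/-! ### §4b BRIDGE TO THE LEAD's SETWISE SPLIT: FV∘'s fibre statement ⇒ ⟨HAAR-TUBE₁⟩ (one-step kinematic tube charge under product Haar, setwise) -/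

/-- ★ **FIBRE TUBE VOLUME ⇒ SETWISE HAAR TUBE CHARGE** (the ⟨HAAR-TUBE₁⟩ letter of LEAD w3-20520 g18's TUBE∘-SPLIT, bus 06:22:42Z, at fixed data; PROVED): if for
`(dU_{J+1}.map D_{J,J+1})`-a.e. `U` in a window `Wn` the conditional Haar law `λ_U` charges `tube_r(σU) ∩ {PlaqSmall θs}` with mass `≥ v`, then for every measurable
`B ⊆ Wn`, `v·dU_{J+1}(D⁻¹B) ≤ dU_{J+1}(D⁻¹B ∩ T′)` with the MOVING tube `T′ = {V | ∀ b, dist1 ((σ (D V) b)⁻¹ * V b) < r}` (σ measurable).  The door of §3 with `w ≡ 1`.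
So FV∘ docks into the setwise split as well (`q′ := v`), and a chartwise letter (px8 g14 `…HaarTubeOneStep`) is the same statement read through WREG's window charts.
[cite: Balaban1985Averaging, (10) p.19 and Prop. 1 p.22] -/
theorem haarTube_of_fibreTubeVolume (F : T3Family) (J : ℕ) (r θs : ℝ) (Wn : Set (GaugeField (F.P J) 0 (Matrix.specialUnitaryGroup (Fin 2) ℂ)))
    (σ : GaugeField (F.P J) 0 (Matrix.specialUnitaryGroup (Fin 2) ℂ) → GaugeField (F.P (J + 1)) 0 (Matrix.specialUnitaryGroup (Fin 2) ℂ)) (_hσm : Measurable σ) {v : ℝ}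
    (HV : ∀ᵐ U ∂((fieldMeasure (F.P (J + 1)) 0 (Matrix.specialUnitaryGroup (Fin 2) ℂ)).map (descendTo F ℰp J (J + 1) (Nat.le_succ J))), U ∈ Wn →
      ENNReal.ofReal v ≤
        (condLaw (fieldMeasure (F.P (J + 1)) 0 (Matrix.specialUnitaryGroup (Fin 2) ℂ)) (descendTo F ℰp J (J + 1) (Nat.le_succ J)) U)
          {W | (∀ b : PBond (F.P (J + 1)) 0, dist1 ((σ U b)⁻¹ * W b) < r) ∧ PlaqSmall θs W}) :
    ∀ B : Set (GaugeField (F.P J) 0 (Matrix.specialUnitaryGroup (Fin 2) ℂ)), MeasurableSet B → B ⊆ Wn →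
      ENNReal.ofReal v * fieldMeasure (F.P (J + 1)) 0 (Matrix.specialUnitaryGroup (Fin 2) ℂ) (descendTo F ℰp J (J + 1) (Nat.le_succ J) ⁻¹' B) ≤
        fieldMeasure (F.P (J + 1)) 0 (Matrix.specialUnitaryGroup (Fin 2) ℂ)
          (descendTo F ℰp J (J + 1) (Nat.le_succ J) ⁻¹' B ∩
            {V | ∀ b : PBond (F.P (J + 1)) 0, dist1 ((σ (descendTo F ℰp J (J + 1) (Nat.le_succ J) V) b)⁻¹ * V b) < r}) := by
  intro B hB hBW
  set μ : Measure (GaugeField (F.P (J + 1)) 0 (Matrix.specialUnitaryGroup (Fin 2) ℂ)) := fieldMeasure (F.P (J + 1)) 0 (Matrix.specialUnitaryGroup (Fin 2) ℂ) with hμ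
  set D₁ : GaugeField (F.P (J + 1)) 0 (Matrix.specialUnitaryGroup (Fin 2) ℂ) → GaugeField (F.P J) 0 (Matrix.specialUnitaryGroup (Fin 2) ℂ) := descendTo F ℰp J (J + 1) (Nat.le_succ J) with hD₁_def
  have hD₁ : Measurable D₁ := measurable_descendTo F ℰp measurableE_ℰp _
  have h1 : μ.withDensity (fun _ => (1 : ℝ≥0∞)) = μ := withDensity_one
  rw [← h1]
  refine mul_le_withDensity_preimage_inter_of_fibrewise μ hD₁ measurable_const (W := Wn)
    (fun U => {W | (∀ b : PBond (F.P (J + 1)) 0, dist1 ((σ U b)⁻¹ * W b) < r) ∧ PlaqSmall θs W})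
    (T := {V | ∀ b : PBond (F.P (J + 1)) 0, dist1 ((σ (D₁ V) b)⁻¹ * V b) < r}) (fun U _ V hVU hVE => ?_) ?_ B hB hBW
  · show ∀ b : PBond (F.P (J + 1)) 0, dist1 ((σ (D₁ V) b)⁻¹ * V b) < r
    rw [hVU]
    exact hVE.1
  haveI : IsMarkovKernel (condLaw μ D₁) := by unfold condLaw; infer_instance
  filter_upwards [HV] with U hU
  intro hUW
  calc ENNReal.ofReal v * ∫⁻ _, (1 : ℝ≥0∞) ∂(condLaw μ D₁ U)
      = ENNReal.ofReal v := by rw [lintegral_const, measure_univ, mul_one, mul_one]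
    _ ≤ (condLaw μ D₁ U) {W | (∀ b : PBond (F.P (J + 1)) 0, dist1 ((σ U b)⁻¹ * W b) < r) ∧ PlaqSmall θs W} := hU hUW
    _ = ∫⁻ _ in {W | (∀ b : PBond (F.P (J + 1)) 0, dist1 ((σ U b)⁻¹ * W b) < r) ∧ PlaqSmall θs W}, (1 : ℝ≥0∞)
          ∂(condLaw μ D₁ U) := by rw [setLIntegral_one]

end Junction

/-! ## §5 THE STUBS (2) and the by-name TUBE∘ concluder -/

/-- STUB · FH∘ (NEW row; the renormalisation content of TUBE∘ in Harnack form). [cite: Balaban1985UV3, Thm 2 p.263 and (41) p.266; Balaban1987RG1, (0.18)-(0.22) p.255] -/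
theorem stub_fibreHarnackCan : FibreHarnackCan := by
  sorry

/-- STUB · FV∘ (NEW row; K-free fibre geometry). [cite: Balaban1985Averaging, (10) p.19 and Prop. 1 p.22] -/
theorem stub_fibreTubeVolumeCan : FibreTubeVolumeCan := by
  sorry

/-- THE UNIQUE TUBE∘ CONCLUDER of this line (PERS₁∘ then by LINE g22-5 v1.1 ✓`SectionLift.oneLevelPersistence_of_tube`). [cite: Balaban1985UV3, (7) p.257 and (38)-(40) p.266] -/
theorem sectionTubeMassIntCan_of_stubs : SectionTubeMassIntCan :=
  sectionTubeMass_of_harnack_volume stub_fibreHarnackCan stub_fibreTubeVolumeCan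

end Summit.QuantumFields.YangMills.Cruxes.FluctuationComparisonRegPrIntL.RunPairOrgan.TubeHarnack

end
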